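import Summits.ResolutionOfSingularities.ResolutionOfSingularities.Theorems.FrobeniusLadderFInjectiveMacaulayficationLaurentCoaction
import Summits.ResolutionOfSingularities.ResolutionOfSingularities.Theorems.FrobeniusLadderFInjectiveMacaulayficationSubalgebraIntegralOfPow
import Mathlib.Algebra.Polynomial.AlgebraMap
import Mathlib.Data.ZMod.Basic
import HarnessLib

/-!
# Degree-zero and Veronese subalgebras of `L[X]` for a Laurent coaction (crux `FInjectiveMacaulayfication`, H-G2 abstract)

Support file for crux stmt-ResolutionOfSingularities-15315 (`FrobeniusLadder.FInjectiveMacaulayfication`,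
registered skeleton v11 `86e9127b`, line `graded-engine`, §16 G4 `stub_gradedChartClause`). [OURS · L1 W4.5a]

Abstract half of helper H-G2 `ReesVeronese` (lead res-L1-w45a-lead-1, `GRADED-ENGINE.md` v2 (i)(ii),
consumer shape `GradedChartClausePlan.reesVeronese`). Given a commutative `k`-algebra `L` graded by a Laurent
coaction `β : L →+* L[T;T⁻¹]` (file `…LaurentCoaction`), grade the polynomial ring `L[X]` by
`deg (ℓ Xᵐ) = deg ℓ - m` (so `X` is the inverse Rees parameter `s = t⁻¹`). This file constructs, with
membership characterizations and no definitions: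

* `exists_subalgebra_of_coaction` — for ANY coaction `γ : L →+* L[M]` and additive `δ : ℕ →+ M`, the
  `k`-subalgebra `{q | ∀ m, γ (q.coeff m) = single (δ m) (q.coeff m)}` of `L[X]`; instances: the degree-`0`
  part `T₀` (`γ = β`, `δ = Nat.cast`) and the `N`-th VERONESE subalgebra `A'` = elements all of whose
  homogeneous components have degree `≡ 0 mod N` (`γ = β̄ := mapDomain (ℤ → ℤ/N) ∘ β`, `δ = Nat.cast`);
* `exists_retraction` — the `A`-linear retraction `ρ : L[X] → A` onto such a subalgebra, `ρ q = Σₘ ((γ qₘ)_{δ m}) Xᵐ`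
  (needs "components are homogeneous" for `γ`; for `β̄` this is `coassoc_mapDomain`);
* `X_pow_mem_veronese` (`X^N ∈ A'`), `le_veronese` (`T₀ ≤ A'`), `C_mem_veronese`,
  `isIntegral_veronese` (`L[X]` is integral over `A'` when `L` is generated by homogeneous elements: every
  generator has its `N`-th power in `A'`; `SubalgebraIntegralOfPow`, #12 p456170).

The unit/transcendence statement `A' ≅ T₀[Y, Y⁻¹]` and the identification of `T₀` with a saturated subring of
`L` are in the sequel `…CoactionReesAway`. Folklore throughout (e.g. Goto–Watanabe, *On graded rings I*, J. Math.
Soc. Japan 30 (1978), Ch. 3 for Veronese subrings `R^{(N)}`); no named facts.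
-/

-- single-problem summit: the doubled namespace component is forced
set_option linter.dupNamespace false

noncomputable section

open scoped LaurentPolynomial Polynomial
open AddMonoidAlgebra LaurentPolynomial
open Summit.ResolutionOfSingularities.ResolutionOfSingularities.Theorems.FInjectiveMacaulayfication
open Summit.ResolutionOfSingularities.ResolutionOfSingularities.Theorems.FInjectiveMacaulayfication.LaurentCoaction

namespace Summit.ResolutionOfSingularities.ResolutionOfSingularities.Theorems.FInjectiveMacaulayfication.CoactionRees

variable {k L : Type} [Field k] [CommRing L] [Algebra k L]

/-! ## Homogeneity for a coaction with values in any group algebra `L[M]` -/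

section Generic

variable {M : Type} [AddCommMonoid M] {γ : L →+* AddMonoidAlgebra L M}

/-- `0` is `γ`-homogeneous of every degree. [folklore] -/
theorem ghom_zero (γ : L →+* AddMonoidAlgebra L M) (d : M) : γ 0 = single d 0 := by
  rw [map_zero, single_zero]

/-- `1` is `γ`-homogeneous of degree `0`. [folklore] -/
theorem ghom_one (γ : L →+* AddMonoidAlgebra L M) : γ 1 = single 0 1 := by
  rw [map_one, one_def]

/-- Sums of `γ`-homogeneous elements of one degree. [folklore] -/
theorem ghom_add {d : M} {a b : L} (ha : γ a = single d a) (hb : γ b = single d b) :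
    γ (a + b) = single d (a + b) := by
  rw [map_add, ha, hb, single_add]

/-- Finite sums of `γ`-homogeneous elements of one degree. [folklore] -/
theorem ghom_sum {ι : Type*} (s : Finset ι) (g : ι → L) (d : M)
    (h : ∀ i ∈ s, γ (g i) = single d (g i)) : γ (∑ i ∈ s, g i) = single d (∑ i ∈ s, g i) := by
  classical
  induction s using Finset.induction_on with
  | empty => rw [Finset.sum_empty, map_zero, single_zero]
  | insert i s hi ih =>
    rw [Finset.sum_insert hi, map_add, h i (Finset.mem_insert_self _ _),
      ih (fun j hj => h j (Finset.mem_insert_of_mem hj)), single_add]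

/-- Products of `γ`-homogeneous elements. [folklore] -/
theorem ghom_mul {d e : M} {a b : L} (ha : γ a = single d a) (hb : γ b = single e b) :
    γ (a * b) = single (d + e) (a * b) := by
  rw [map_mul, ha, hb, single_mul_single]

/-- **The subalgebra cut out by a coaction and a degree function**: for `γ : L →+* L[M]` sending `k` to degree
`0` and an additive `δ : ℕ →+ M`, the polynomials whose `m`-th coefficient is `γ`-homogeneous of degree `δ m`
form a `k`-subalgebra of `L[X]`. [folklore] -/
theorem exists_subalgebra_of_coaction (γ : L →+* AddMonoidAlgebra L M) (δ : ℕ →+ M)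
    (hγk : ∀ c : k, γ (algebraMap k L c) = single 0 (algebraMap k L c)) :
    ∃ A : Subalgebra k L[X], ∀ q : L[X], q ∈ A ↔ ∀ m : ℕ, γ (q.coeff m) = single (δ m) (q.coeff m) := by
  refine ⟨{ carrier := {q | ∀ m : ℕ, γ (q.coeff m) = single (δ m) (q.coeff m)}
            mul_mem' := ?_, one_mem' := ?_, add_mem' := ?_, zero_mem' := ?_, algebraMap_mem' := ?_ },
    fun q => Iff.rfl⟩
  · intro a b ha hb m
    rw [Polynomial.coeff_mul]
    refine ghom_sum _ _ _ fun x hx => ?_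
    have h := ghom_mul (ha x.1) (hb x.2)
    rwa [← map_add, Finset.mem_antidiagonal.mp hx] at h
  · intro m
    rw [Polynomial.coeff_one]
    split_ifs with h
    · rw [h, map_zero]; exact ghom_one γ
    · exact ghom_zero γ _
  · intro a b ha hb m
    rw [Polynomial.coeff_add]
    exact ghom_add (ha m) (hb m)
  · intro m
    rw [Polynomial.coeff_zero]
    exact ghom_zero γ _
  · intro c m
    show γ ((algebraMap k L[X] c).coeff m) = single (δ m) ((algebraMap k L[X] c).coeff m)
    rw [Polynomial.algebraMap_apply, Polynomial.coeff_C]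
    split_ifs with h
    · rw [h, map_zero]; exact hγk c
    · exact ghom_zero γ _

/-- **The retraction onto the subalgebra of a coaction**: if the components `(γ ℓ)ₓ` are themselves
`γ`-homogeneous of degree `x`, then `q ↦ Σₘ ((γ qₘ)_{δ m}) Xᵐ` is an `A`-linear retraction `L[X] → A` of the
inclusion of the subalgebra `A` of `exists_subalgebra_of_coaction`. [folklore] -/
theorem exists_retraction {M : Type} [AddCommGroup M] (γ : L →+* AddMonoidAlgebra L M) (δ : ℕ →+ M)
    (hΔ : ∀ (ℓ : L) (x : M), γ ((γ ℓ).coeff x) = single x ((γ ℓ).coeff x))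
    (A : Subalgebra k L[X]) (hA : ∀ q : L[X], q ∈ A ↔ ∀ m : ℕ, γ (q.coeff m) = single (δ m) (q.coeff m)) :
    ∃ ρ : L[X] →ₗ[A] A, ∀ a : A, ρ a = a := by
  classical
  let r : L[X] → L[X] := fun q => ∑ m ∈ q.support, Polynomial.monomial m ((γ (q.coeff m)).coeff (δ m))
  have hr : ∀ (q : L[X]) (m : ℕ), (r q).coeff m = (γ (q.coeff m)).coeff (δ m) := by
    intro q m
    simp only [r, Polynomial.finsetSum_coeff, Polynomial.coeff_monomial]
    rw [Finset.sum_ite_eq' q.support m]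
    split_ifs with h
    · rfl
    · rw [Polynomial.notMem_support_iff.mp h, map_zero, coeff_zero, Finsupp.zero_apply]
  have hmem : ∀ q, r q ∈ A := fun q => (hA _).mpr fun m => by rw [hr]; exact hΔ _ _
  have hadd : ∀ a b, r (a + b) = r a + r b := fun a b => Polynomial.ext fun m => by
    simp only [hr, Polynomial.coeff_add, map_add, coeff_add, Finsupp.add_apply]
  have hsmul : ∀ (a : A) (q : L[X]), r ((a : L[X]) * q) = (a : L[X]) * r q := fun a q =>
    Polynomial.ext fun m => by
      rw [hr, Polynomial.coeff_mul, Polynomial.coeff_mul, map_sum, coeff_sum, Finsupp.finsetSum_apply]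
      refine Finset.sum_congr rfl fun x hx => ?_
      have hx' : δ x.1 + δ x.2 = δ m := by rw [← map_add, Finset.mem_antidiagonal.mp hx]
      rw [map_mul, (hA _).mp a.2 x.1, ← hx', coeff_single_mul_add, hr]
  have hid : ∀ a : A, r a = a := fun a => Polynomial.ext fun m => by
    rw [hr, (hA _).mp a.2 m, coeff_single, Finsupp.single_eq_same]
  refine ⟨{ toFun := fun q => ⟨r q, hmem q⟩
            map_add' := fun a b => Subtype.ext (hadd a b)
            map_smul' := fun a q => Subtype.ext ?_ }, fun a => Subtype.ext (hid a)⟩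
  show r (a • q) = (((RingHom.id A) a • (⟨r q, hmem q⟩ : A) : A) : L[X])
  rw [RingHom.id_apply, Subalgebra.smul_def, smul_eq_mul, smul_eq_mul, Subalgebra.coe_mul]
  exact hsmul a q

end Generic

/-! ## The coarse coaction `β̄ = mapDomain (ℤ → ℤ/N) ∘ β` -/

section Coarse

variable (β : L →+* L[T;T⁻¹]) {M : Type} [AddCommGroup M] (φ : ℤ →+ M)

/-- Coefficients of `mapDomain φ P` are the sums of the coefficients of `P` over the fibres of `φ`. [folklore] -/
theorem coeff_mapDomain_eq_sum [DecidableEq M] (P : L[T;T⁻¹]) (x : M) :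
    (mapDomainRingHom L φ P).coeff x = ∑ j ∈ P.coeff.support with φ j = x, P.coeff j := by
  rw [mapDomainRingHom_apply, coeff_mapDomain, Finsupp.mapDomain, Finsupp.sum_apply, Finsupp.sum,
    Finset.sum_filter]
  refine Finset.sum_congr rfl fun j _ => ?_
  rw [Finsupp.single_apply]

/-- A `β`-homogeneous element of degree `d` is `β̄`-homogeneous of degree `φ d`. [folklore] -/
theorem hom_mapDomain {d : ℤ} {ℓ : L} (h : β ℓ = single d ℓ) :
    (mapDomainRingHom L φ).comp β ℓ = single (φ d) ℓ := by
  rw [RingHom.comp_apply, h, mapDomainRingHom_apply, mapDomain_single]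

/-- `β̄` sends `k` to degree `0` if `β` does. [folklore] -/
theorem mapDomain_algebraMap (hk : ∀ c : k, β (algebraMap k L c) = LaurentPolynomial.C (algebraMap k L c))
    (c : k) : (mapDomainRingHom L φ).comp β (algebraMap k L c) = single 0 (algebraMap k L c) := by
  rw [← map_zero φ]
  exact hom_mapDomain β φ (hk c)

/-- **Coassociativity passes to the coarse coaction**: if the `β`-components are `β`-homogeneous then the
`β̄`-components (sums of `β`-components over residue classes) are `β̄`-homogeneous. [folklore] -/
theorem coassoc_mapDomain [DecidableEq M] (hΔ : ∀ (ℓ : L) (i : ℤ), β ((β ℓ).coeff i) = single i ((β ℓ).coeff i))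
    (ℓ : L) (x : M) :
    (mapDomainRingHom L φ).comp β (((mapDomainRingHom L φ).comp β ℓ).coeff x) =
      single x (((mapDomainRingHom L φ).comp β ℓ).coeff x) := by
  have hS : ((mapDomainRingHom L φ).comp β ℓ).coeff x = ∑ j ∈ (β ℓ).coeff.support with φ j = x, (β ℓ).coeff j := by
    rw [RingHom.comp_apply, coeff_mapDomain_eq_sum]
  rw [hS]
  refine ghom_sum _ _ _ fun j hj => ?_
  rw [(Finset.mem_filter.mp hj).2.symm]
  exact hom_mapDomain β φ (hΔ ℓ j)

end Coarse

/-! ## The Veronese subalgebra `A'` and the degree-zero subalgebra `T₀` -/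

section Veronese

variable (β : L →+* L[T;T⁻¹]) (N : ℕ) (T₀ A' : Subalgebra k L[X])
  (hT₀ : ∀ q : L[X], q ∈ T₀ ↔ ∀ m : ℕ, β (q.coeff m) = single (m : ℤ) (q.coeff m))
  (hA' : ∀ q : L[X], q ∈ A' ↔ ∀ m : ℕ,
    (mapDomainRingHom L (Int.castAddHom (ZMod N))).comp β (q.coeff m) = single (m : ZMod N) (q.coeff m))

/-- A `β`-homogeneous element of degree `d` is `β̄`-homogeneous of degree `d mod N`. [folklore] -/
theorem hom_zmod {d : ℤ} {ℓ : L} (h : β ℓ = single d ℓ) :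
    (mapDomainRingHom L (Int.castAddHom (ZMod N))).comp β ℓ = single (d : ZMod N) ℓ :=
  hom_mapDomain β _ h

include hA' in
/-- `X ^ N ∈ A'`: its only coefficient `1` sits in `X`-degree `N ≡ 0`. [folklore] -/
theorem X_pow_mem_veronese : (Polynomial.X : L[X]) ^ N ∈ A' := by
  refine (hA' _).mpr fun m => ?_
  rw [Polynomial.coeff_X_pow]
  split_ifs with h
  · rw [h, ZMod.natCast_self]
    exact ghom_one _
  · exact ghom_zero _ _

include hA' in
/-- A constant `C ℓ` with `ℓ` homogeneous of degree divisible by `N` lies in `A'`. [folklore] -/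
theorem C_mem_veronese {ℓ : L} {d : ℤ} (hℓ : β ℓ = single d ℓ) (hd : (N : ℤ) ∣ d) :
    Polynomial.C ℓ ∈ A' := by
  refine (hA' _).mpr fun m => ?_
  rw [Polynomial.coeff_C]
  split_ifs with h
  · rw [h, Nat.cast_zero, hom_zmod β N hℓ, (ZMod.intCast_zmod_eq_zero_iff_dvd d N).mpr hd]
  · exact ghom_zero _ _

include hT₀ hA' in
/-- `T₀ ≤ A'`. [folklore] -/
theorem le_veronese : T₀ ≤ A' := fun q hq => (hA' q).mpr fun m => by
  rw [hom_zmod β N ((hT₀ q).mp hq m), Int.cast_natCast]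

include hT₀ in
/-- Monomials `C ℓ * X ^ m` with `ℓ` homogeneous of degree `m` lie in `T₀`. [folklore] -/
theorem C_mul_X_pow_mem_degreeZero {ℓ : L} {m : ℕ} (hℓ : β ℓ = single (m : ℤ) ℓ) :
    Polynomial.C ℓ * Polynomial.X ^ m ∈ T₀ := by
  refine (hT₀ _).mpr fun m' => ?_
  rw [Polynomial.coeff_C_mul_X_pow]
  split_ifs with h
  · rw [h]; exact hℓ
  · exact hom_zero β _

/-- `L[X]` is generated over `k` by the constants from a generating set of `L` together with `X`. [folklore] -/
theorem adjoin_C_image_union_X (G : Set L) (hgen : Algebra.adjoin k G = ⊤) :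
    Algebra.adjoin k ((algebraMap L L[X]) '' G ∪ {Polynomial.X}) = ⊤ := by
  have hC : ∀ a : L, Polynomial.C a ∈ Algebra.adjoin k ((algebraMap L L[X]) '' G ∪ {Polynomial.X}) := by
    intro a
    have ha : a ∈ Algebra.adjoin k G := by rw [hgen]; exact Algebra.mem_top
    have h : IsScalarTower.toAlgHom k L L[X] a ∈ (Algebra.adjoin k G).map (IsScalarTower.toAlgHom k L L[X]) :=
      Subalgebra.mem_map.mpr ⟨a, ha, rfl⟩
    rw [AlgHom.map_adjoin] at h
    exact Algebra.adjoin_mono Set.subset_union_left h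
  have hX : (Polynomial.X : L[X]) ∈ Algebra.adjoin k ((algebraMap L L[X]) '' G ∪ {Polynomial.X}) :=
    Algebra.subset_adjoin (Set.mem_union_right _ rfl)
  have key : ∀ q : L[X], q ∈ Algebra.adjoin k ((algebraMap L L[X]) '' G ∪ {Polynomial.X}) := fun q => by
    induction q using Polynomial.induction_on with
    | C a => exact hC a
    | add p q hp hq => exact Subalgebra.add_mem _ hp hq
    | monomial m a h =>
      rw [pow_succ, ← mul_assoc]
      exact Subalgebra.mul_mem _ h hX
  exact eq_top_iff.mpr fun q _ => key q

include hA' in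
/-- **`L[X]` is integral over the Veronese subalgebra** when `L` is generated over `k` by homogeneous
elements: each generator `g` (degree `d`) has `(C g)^N = C (g^N)` of degree `N d ≡ 0`, hence in `A'`, and
`X ^ N ∈ A'` (`SubalgebraIntegralOfPow`, #12). [folklore] -/
theorem isIntegral_veronese (hN : 0 < N) (G : Set L) (hG : ∀ g ∈ G, ∃ d : ℤ, β g = single d g)
    (hgen : Algebra.adjoin k G = ⊤) : Algebra.IsIntegral A' L[X] := by
  refine SubalgebraIntegralOfPow.stub_subalgebraIntegralOfPow k L[X] A'
    ((algebraMap L L[X]) '' G ∪ {Polynomial.X}) (adjoin_C_image_union_X G hgen) ?_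
  rintro y (⟨g, hg, rfl⟩ | rfl)
  · obtain ⟨d, hd⟩ := hG g hg
    refine ⟨N, hN, ?_⟩
    rw [← map_pow, Polynomial.algebraMap_eq]
    exact C_mem_veronese β N A' hA' (hom_pow hd N) (Dvd.intro d rfl)
  · exact ⟨N, hN, X_pow_mem_veronese β N A' hA'⟩

end Veronese

end Summit.ResolutionOfSingularities.ResolutionOfSingularities.Theorems.FInjectiveMacaulayfication.CoactionRees

end
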